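import Summits.ResolutionOfSingularities.ResolutionOfSingularities.Theorems.FrobeniusLadderFInjectiveMacaulayficationClusterGrowthStepDimThree
import HarnessLib

/-!
# The CLUSTER-GROWTH ITERATION in a stable arena `T`: invariant-preserving step, the honest recursion, and its discharge at local dimension 3
# (crux `FInjectiveMacaulayfication` stmt-ResolutionOfSingularities-15315, chain w45a; res-L1-w45a-plan-1 RULING R16.53 (1) «@stub-1 NEXT: take
# `clusterGrowth_iterate` … state it honestly as a one-step-at-a-time recursion … the ARENA INVARIANTS made explicit: (i) all payment inside T,
# (ii) J unchanged off T, (iii) NonInv stays in T»; seat res-L1-w45a-stub-1 g6)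

[OURS · L1 W4.5a] Support file (`--supports stmt-ResolutionOfSingularities-15315 --as helper`); NOT a statement of any manuscript; def-free;
conditional on `NonFullLocusClosed` (and, for the discharge, CP 2019 Thm. 1.1 + Raynaud–Gruson + CP 2019 Prop. 4.4) BY NAME; AI-written (AI
review is weaker than expert review).

THE ARENA. Fix a closed `T ⊆ X₁` (the «stable arena», in practice `T ⊇ Sing X₁ ∪ NonPrinc J₀`). A STATE is a centre `J ≠ ⊥` with
`NonPrinc J ⊆ T` and `J = J₀` off `T` (stalkwise), together with a good set `G ⊇ S ∖ T` (`GoodOver p X₁ J G`).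
* §1 `clusterGrowth_step_arena (hNF)`: ONE step at `ζ` with dominating local data `(c, d)` for the CURRENT `J` and `(I_T)_ζ ≤ √(c)`: the new
  state is `(J · J″, (G ∖ supp J″) ∪ U)` with `supp J″ ⊆ T`, `ζ ∈ U`, every blowing up along `J · J″` FULL over `U` — and ALL THREE INVARIANTS
  are kept: payment only inside `supp J″ ⊆ T` (so `S ∖ T` stays good), `J · J″ = J = J₀` off `T`, `NonPrinc (J · J″) ⊆ T`. (res-L1-w45a-lead-1's
  `ClusterGrowthStep.clusterGrowth_step` with `Z := T`, re-sharpened to pay only on `supp J″` by `GoodOverMul.goodOver_mul_diff_support`.)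
* §2 `clusterGrowth_iterate_arena (hNF) (oracle)`: the HONEST recursion over a finite list of admissible points of `T` (admissibility = any
  predicate `Adm`; the ORACLE supplies, for every state-centre `J` and admissible `ζ ∈ T`, dominating data with `(I_T)_ζ ≤ √(c)`): from
  `(J₀, S)` one reaches a state `(J, G)` with the invariants and with the LAST-cured point inside an open `U ⊆ G`. WHAT IT DOES NOT SAY
  (termination caveat, documented on purpose): earlier cured points keep their neighbourhoods only OFF the supports of LATER payments
  (`G_{i+1} = (G_i ∖ supp J″_{i+1}) ∪ U_{i+1}`), so the `U`'s need not cover `T` and a point cured early may be spoiled later — the list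
  `ζ :: rest` is processed `rest` first, `ζ` last.
* §3 `oracle_dimThree_of_facts (hG h081R hP)`: the oracle IS a theorem at points of local dimension `3` of an arena `T ⊇ Sing X₁`
  (`ClusterGrowthStepDimThree.exists_productCompatible_locFix_dimThree_hrad`); `clusterGrowth_iterate_dimThree (hG h081R hP hNF)`: the
  recursion with the oracle discharged (admissible = local dimension `3`). Local dimension `≤ 2` awaits the support clause of the Lipman model.
[cite: DattaMurayama2024, Thm. B] [cite: CossartPiltant2019, Thm. 1.1 (i)(ii); Prop. 4.4] [cite: StacksProject, Tag 01J7; Tag 0804]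
-/

-- single-problem summit: the doubled namespace component is forced
set_option linter.dupNamespace false

noncomputable section

namespace Summit.ResolutionOfSingularities.ResolutionOfSingularities.Theorems.FInjectiveMacaulayfication.ClusterGrowthIterate

open CategoryTheory CategoryTheory.Limits AlgebraicGeometry TopologicalSpace IsLocalRing
open Literature.AlgebraicGeometry.Resolution
open Summit.ResolutionOfSingularities.ResolutionOfSingularities.Theorems.FInjectiveMacaulayfication
open SliceableCentre FCUnguardedAprime
open Scheme.IdealSheafData

/-! ## §1 The invariant-preserving step -/

/-- **ONE CLUSTER-GROWTH STEP PRESERVING THE ARENA INVARIANTS.** State `(J, G)`: `J ≠ ⊥`, `NonPrinc J ⊆ T`, `J = J₀` off `T`, `S ∖ T ⊆ G`,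
`GoodOver p X₁ J G`. Given dominating data `(c, d)` for `J` at `ζ` with `(I_T)_ζ ≤ √(c)`, the new state `(J · J″, (G ∖ supp J″) ∪ U)` satisfies
the same invariants, with `supp J″ ⊆ T`, `ζ ∈ U` and every blowing up along `J · J″` FULL over `U`. [OURS · conditional on `NonFullLocusClosed`]
[cite: DattaMurayama2024, Thm. B] -/
theorem clusterGrowth_step_arena (hNF : NonFullLocusClosed.NonFullLocusClosed)
    (p : ℕ) (hp : p.Prime) (k : Type) [Field k] [CharP k p] (X₁ : Scheme.{0}) (f₁ : X₁ ⟶ Spec (.of k))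
    [LocallyOfFiniteType f₁] [QuasiCompact f₁] [IsIntegral X₁]
    (T : Set X₁) (hT : IsClosed T) (J₀ J : X₁.IdealSheafData) (S G : Set X₁)
    (hJ : J ≠ ⊥) (hNI : {y : X₁ | ¬ IsLocallyPrincipalAt J y} ⊆ T) (hoff : ∀ x : X₁, x ∉ T → stalkIdeal J x = stalkIdeal J₀ x)
    (hSG : S \ T ⊆ G) (hG : GoodOver p X₁ J G)
    (ζ : X₁) {m : ℕ} (c : Fin m → X₁.presheaf.stalk ζ) (hc0 : Ideal.span (Set.range c) ≠ ⊥)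
    {n : ℕ} (d : Fin n → X₁.presheaf.stalk ζ) (hd : Ideal.span (Set.range d) = stalkIdeal J ζ * Ideal.span (Set.range c))
    (hfull : ∀ (j : Fin n) (𝔔 : PrimeSpectrum (blowupAlgebra (Ideal.span (Set.range d)) (d j))),
      𝔔.asIdeal.comap (algebraMap (X₁.presheaf.stalk ζ) (blowupAlgebra (Ideal.span (Set.range d)) (d j))) =
        maximalIdeal (X₁.presheaf.stalk ζ) → FullCl p (Localization.AtPrime 𝔔.asIdeal))
    (hrad : stalkIdeal (vanishingIdeal ⟨T, hT⟩) ζ ≤ (Ideal.span (Set.range c)).radical) :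
    ∃ (J'' : X₁.IdealSheafData) (U : X₁.Opens),
      J'' ≠ ⊥ ∧ (J''.support : Set X₁) ⊆ T ∧ ζ ∈ (U : Set X₁) ∧
      (∀ (X₂ : Scheme.{0}) (π : X₂ ⟶ X₁), IsBlowup π (J * J'') → ∀ x : X₂, π.base x ∈ (U : Set X₁) → FullCl p (X₂.presheaf.stalk x)) ∧
      J * J'' ≠ ⊥ ∧ {y : X₁ | ¬ IsLocallyPrincipalAt (J * J'') y} ⊆ T ∧
      (∀ x : X₁, x ∉ T → stalkIdeal (J * J'') x = stalkIdeal J₀ x) ∧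
      S \ T ⊆ (G \ (J''.support : Set X₁)) ∪ (U : Set X₁) ∧
      GoodOver p X₁ (J * J'') ((G \ (J''.support : Set X₁)) ∪ (U : Set X₁)) := by
  classical
  haveI : IsLocallyNoetherian X₁ := LocallyOfFiniteType.isLocallyNoetherian f₁
  haveI : JacobsonSpace X₁ := LocallyOfFiniteType.jacobsonSpace f₁
  obtain ⟨J'', U, hJ'', -, hsupp, hζU, hU, hgood⟩ :=
    ClusterGrowthStep.clusterGrowth_step hNF p hp k X₁ f₁ J hJ G hG ζ c hc0 d hd hfull T hT hrad
  -- stalks off `T` are untouched (`supp J″ ⊆ T`)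
  have hst : ∀ x : X₁, x ∉ T → stalkIdeal (J * J'') x = stalkIdeal J x := fun x hx =>
    GoodOverMul.stalkIdeal_mul_eq_of_notMem_support J J'' (fun h => hx (hsupp h))
  refine ⟨J'', U, hJ'', hsupp, hζU, hU, ?_, ?_, ?_, ?_, ?_⟩
  · -- `J · J″ ≠ ⊥`
    intro h0
    have h1 : stalkIdeal (J * J'') ζ = ⊥ := by rw [h0]; exact stalkIdeal_bot ζ
    rw [stalkIdeal_mul] at h1
    rcases Ideal.mul_eq_bot.mp h1 with h | h
    · exact stalkIdeal_ne_bot_of_ne_bot hJ ζ h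
    · exact stalkIdeal_ne_bot_of_ne_bot hJ'' ζ h
  · -- `NonPrinc (J · J″) ⊆ T`
    intro y hy
    by_contra hyT
    apply hy
    have hJy : IsLocallyPrincipalAt J y := by
      by_contra h
      exact hyT (hNI h)
    rw [isLocallyPrincipalAt_iff_isPrincipal_stalkIdeal] at hJy ⊢
    rw [hst y hyT]
    exact hJy
  · exact fun x hx => (hst x hx).trans (hoff x hx)
  · exact fun x hx => Or.inl ⟨hSG hx, fun h => hx.2 (hsupp h)⟩
  · exact RelClosedFixR.goodOver_union (GoodOverMul.goodOver_mul_diff_support hG)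
      (RelClosedSubsetFixFinite.goodOver_mono Set.subset_union_right hgood)

/-! ## §2 The honest recursion -/

/-- **THE CLUSTER-GROWTH RECURSION IN THE ARENA `T`** (honest form). `Adm` = admissible points; the ORACLE gives, for every centre `J ≠ ⊥` with
`NonPrinc J ⊆ T` and every admissible `ζ ∈ T`, dominating data `(c, d)` for `J` at `ζ` with charts FULL over `𝔪_ζ` and `(I_T)_ζ ≤ √(c)`. Then
for every finite list of admissible points of `T` (processed tail first, head LAST), from `(J₀, S)` one reaches a state `(J, G)` with: `J ≠ ⊥`,
`NonPrinc J ⊆ T`, `J = J₀` off `T`, `S ∖ T ⊆ G`, `GoodOver p X₁ J G`, and the head of the list inside an open `U ⊆ G`. (Earlier points keep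
their neighbourhoods only off later payment supports — NOT asserted.) [OURS · conditional on `NonFullLocusClosed`] [cite: DattaMurayama2024, Thm. B] -/
theorem clusterGrowth_iterate_arena (hNF : NonFullLocusClosed.NonFullLocusClosed)
    (p : ℕ) (hp : p.Prime) (k : Type) [Field k] [CharP k p] (X₁ : Scheme.{0}) (f₁ : X₁ ⟶ Spec (.of k))
    [LocallyOfFiniteType f₁] [QuasiCompact f₁] [IsIntegral X₁]
    (T : Set X₁) (hT : IsClosed T) (Adm : X₁ → Prop)
    (oracle : ∀ J : X₁.IdealSheafData, J ≠ ⊥ → {y : X₁ | ¬ IsLocallyPrincipalAt J y} ⊆ T → ∀ ζ : X₁, ζ ∈ T → Adm ζ →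
      ∃ (m : ℕ) (c : Fin m → X₁.presheaf.stalk ζ) (n : ℕ) (d : Fin n → X₁.presheaf.stalk ζ),
        Ideal.span (Set.range c) ≠ ⊥ ∧ Ideal.span (Set.range d) = stalkIdeal J ζ * Ideal.span (Set.range c) ∧
        (∀ (j : Fin n) (𝔔 : PrimeSpectrum (blowupAlgebra (Ideal.span (Set.range d)) (d j))),
          𝔔.asIdeal.comap (algebraMap (X₁.presheaf.stalk ζ) (blowupAlgebra (Ideal.span (Set.range d)) (d j))) =
            maximalIdeal (X₁.presheaf.stalk ζ) → FullCl p (Localization.AtPrime 𝔔.asIdeal)) ∧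
        stalkIdeal (vanishingIdeal ⟨T, hT⟩) ζ ≤ (Ideal.span (Set.range c)).radical)
    (J₀ : X₁.IdealSheafData) (hJ₀ : J₀ ≠ ⊥) (hNI₀ : {y : X₁ | ¬ IsLocallyPrincipalAt J₀ y} ⊆ T)
    (S : Set X₁) (hS : GoodOver p X₁ J₀ S) :
    ∀ (ζs : List X₁), (∀ ζ ∈ ζs, ζ ∈ T ∧ Adm ζ) →
      ∃ (J : X₁.IdealSheafData) (G : Set X₁), J ≠ ⊥ ∧ {y : X₁ | ¬ IsLocallyPrincipalAt J y} ⊆ T ∧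
        (∀ x : X₁, x ∉ T → stalkIdeal J x = stalkIdeal J₀ x) ∧ S \ T ⊆ G ∧ GoodOver p X₁ J G ∧
        (∀ ζ : X₁, ζs.head? = some ζ → ∃ U : X₁.Opens, ζ ∈ (U : Set X₁) ∧ (U : Set X₁) ⊆ G) := by
  intro ζs
  induction ζs with
  | nil =>
    intro _
    exact ⟨J₀, S, hJ₀, hNI₀, fun x _ => rfl, Set.sdiff_subset, hS, fun ζ h => by simp at h⟩
  | cons ζ rest ih =>
    intro hadm
    obtain ⟨J, G, hJ, hNI, hoff, hSG, hG, -⟩ := ih fun η hη => hadm η (List.mem_cons_of_mem ζ hη)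
    obtain ⟨hζT, hζA⟩ := hadm ζ List.mem_cons_self
    obtain ⟨m, c, n, d, hc0, hd, hfull, hrad⟩ := oracle J hJ hNI ζ hζT hζA
    obtain ⟨J'', U, -, -, hζU, -, hJJ, hNI', hoff', hSG', hG'⟩ :=
      clusterGrowth_step_arena hNF p hp k X₁ f₁ T hT J₀ J S G hJ hNI hoff hSG hG ζ c hc0 d hd hfull hrad
    refine ⟨J * J'', (G \ (J''.support : Set X₁)) ∪ (U : Set X₁), hJJ, hNI', hoff', hSG', hG', fun η hη => ?_⟩
    have hηζ : η = ζ := by simpa using hη.symm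
    subst hηζ
    exact ⟨U, hζU, Set.subset_union_right⟩

/-! ## §3 The oracle at local dimension three is a theorem (Cossart–Piltant) -/

/-- **The oracle holds at points of local dimension `3` of an arena `T ⊇ Sing X₁`** — `ClusterGrowthStepDimThree.exists_productCompatible_locFix_dimThree_hrad`
(charts REGULAR and FULL at every prime; `(I_T)_ζ ≤ √(c)` for `T ⊇ Sing X₁ ∪ NonPrinc J`). [OURS · conditional-result]
[cite: CossartPiltant2019, Thm. 1.1 (i)(ii); Prop. 4.4] [cite: StacksProject, Tag 01J7] -/
theorem oracle_dimThree_of_facts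
    (hG : CossartPiltant2019General.{0}) (h081R : Stacks081R.{0}) (hP : CossartPiltant2019Principalization.{0})
    (p : ℕ) [Fact p.Prime] {k : Type} [Field k] [CharP k p] {X₁ : Scheme.{0}} (f₁ : X₁ ⟶ Spec (.of k))
    [LocallyOfFiniteType f₁] [IsIntegral X₁]
    (T : Set X₁) (hT : IsClosed T) (harena : (Scheme.regularLocus X₁)ᶜ ⊆ T) :
    ∀ J : X₁.IdealSheafData, J ≠ ⊥ → {y : X₁ | ¬ IsLocallyPrincipalAt J y} ⊆ T → ∀ ζ : X₁, ζ ∈ T →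
      ringKrullDim (X₁.presheaf.stalk ζ) = 3 →
      ∃ (m : ℕ) (c : Fin m → X₁.presheaf.stalk ζ) (n : ℕ) (d : Fin n → X₁.presheaf.stalk ζ),
        Ideal.span (Set.range c) ≠ ⊥ ∧ Ideal.span (Set.range d) = stalkIdeal J ζ * Ideal.span (Set.range c) ∧
        (∀ (j : Fin n) (𝔔 : PrimeSpectrum (blowupAlgebra (Ideal.span (Set.range d)) (d j))),
          𝔔.asIdeal.comap (algebraMap (X₁.presheaf.stalk ζ) (blowupAlgebra (Ideal.span (Set.range d)) (d j))) =
            maximalIdeal (X₁.presheaf.stalk ζ) → FullCl p (Localization.AtPrime 𝔔.asIdeal)) ∧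
        stalkIdeal (vanishingIdeal ⟨T, hT⟩) ζ ≤ (Ideal.span (Set.range c)).radical := by
  intro J hJ hNI ζ _ hdim
  obtain ⟨m, c, n, d, hc0, hd, hfull, hrad⟩ :=
    ClusterGrowthStepDimThree.exists_productCompatible_locFix_dimThree_hrad hG h081R hP p f₁ ζ hdim J hJ
  exact ⟨m, c, n, d, hc0, hd, fun j 𝔔 _ => (hfull j 𝔔).2, hrad T hT (Set.union_subset harena hNI)⟩

/-- **The cluster-growth recursion at residual points of local dimension `3`, oracle discharged** (CP 2019 + Raynaud–Gruson + CP principalization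
+ `NonFullLocusClosed` BY NAME), in an arena `T ⊇ Sing X₁ ∪ NonPrinc J₀`. [OURS · conditional-result]
[cite: CossartPiltant2019, Thm. 1.1 (i)(ii); Prop. 4.4] [cite: DattaMurayama2024, Thm. B] -/
theorem clusterGrowth_iterate_dimThree
    (hG : CossartPiltant2019General.{0}) (h081R : Stacks081R.{0}) (hP : CossartPiltant2019Principalization.{0})
    (hNF : NonFullLocusClosed.NonFullLocusClosed)
    (p : ℕ) (hp : p.Prime) (k : Type) [Field k] [CharP k p] (X₁ : Scheme.{0}) (f₁ : X₁ ⟶ Spec (.of k))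
    [LocallyOfFiniteType f₁] [QuasiCompact f₁] [IsIntegral X₁]
    (T : Set X₁) (hT : IsClosed T) (harena : (Scheme.regularLocus X₁)ᶜ ⊆ T)
    (J₀ : X₁.IdealSheafData) (hJ₀ : J₀ ≠ ⊥) (hNI₀ : {y : X₁ | ¬ IsLocallyPrincipalAt J₀ y} ⊆ T)
    (S : Set X₁) (hS : GoodOver p X₁ J₀ S) :
    ∀ (ζs : List X₁), (∀ ζ ∈ ζs, ζ ∈ T ∧ ringKrullDim (X₁.presheaf.stalk ζ) = 3) →
      ∃ (J : X₁.IdealSheafData) (G : Set X₁), J ≠ ⊥ ∧ {y : X₁ | ¬ IsLocallyPrincipalAt J y} ⊆ T ∧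
        (∀ x : X₁, x ∉ T → stalkIdeal J x = stalkIdeal J₀ x) ∧ S \ T ⊆ G ∧ GoodOver p X₁ J G ∧
        (∀ ζ : X₁, ζs.head? = some ζ → ∃ U : X₁.Opens, ζ ∈ (U : Set X₁) ∧ (U : Set X₁) ⊆ G) := by
  haveI : Fact p.Prime := ⟨hp⟩
  exact clusterGrowth_iterate_arena hNF p hp k X₁ f₁ T hT (fun ζ => ringKrullDim (X₁.presheaf.stalk ζ) = 3)
    (oracle_dimThree_of_facts hG h081R hP p f₁ T hT harena) J₀ hJ₀ hNI₀ S hS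

end Summit.ResolutionOfSingularities.ResolutionOfSingularities.Theorems.FInjectiveMacaulayfication.ClusterGrowthIterate

end
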